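import Mathlib
import HarnessLib.Audit

/-!
# Rung C1 of the crux `EulerZoomLiouville.PowerGaugeEulerLiouville`: quantitative `C²` bounds along the kernel-line
# graph (step F2 of the top-node closure plan)

Route №10 `EulerZoomLiouville` (NavierStokesRegularity), crux E = stmt-NavierStokesRegularity-19832,
tenure rung C1 (exactly self-similar members), registered residue `stub_selfSimilarExtremal`.
Sixteenth file of the NODAL-CONTINUUM line (lineage ns-typeII-p1, gen 7).  The kernel-line graph `Γ` of
`exists_kernelGraph_of_corankOne` is `C²` on `(−δ, δ)` with `Γ'(0) = e`; the exit analysis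
(`false_of_topBadNode_of_arc` and the closure plan) consumes the `C^{1,1}` bounds `|g'(σ)| ≤ L|σ|` for
`g = Γ − z₀ − σe` and `|φ'(σ)| ≤ C₁|σ|`, `|φ(σ)| ≤ C₁σ²` for `φ = ⟪e, V∘Γ⟫`.  Both are instances of the
elementary lemma below:

* `exists_deriv_le_mul_abs_of_contDiffOn_two` — a function `C²` on `(−δ, δ)` with `f'(0) = 0` satisfies, on
  `[−δ/2, δ/2]`, `HasDerivAt f (f' σ) σ` and `‖f'(σ)‖ ≤ L|σ|` for some `L ≥ 0` (mean value inequality for `f'`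
  with `‖f''‖ ≤ L` on the compact interval);
* `norm_sub_le_mul_sq_of_deriv_le` — hence `‖f(σ) − f(0)‖ ≤ Lσ²`.

WHAT THIS IS NOT: not NS, not E — elementary calculus. [folklore]
-/

noncomputable section

-- flat `Theorems/<Route><Decl>…` files of one crux share the namespace of the crux (tree convention)
set_option linter.dupNamespace false

open Set Filter Topology Metric Function

namespace Summit.NavierStokesRegularity.NavierStokesRegularity.Theorems.PowerGaugeEulerLiouville.NodalContinuum

variable {F : Type*} [NormedAddCommGroup F] [NormedSpace ℝ F]

/-- **`C²` on `(−δ, δ)` with `f'(0) = 0` ⇒ `‖f'(σ)‖ ≤ L|σ|` on `[−δ/2, δ/2]`.** [folklore] -/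
theorem exists_deriv_le_mul_abs_of_contDiffOn_two {f : ℝ → F} {δ : ℝ} (hδ : 0 < δ)
    (hf : ContDiffOn ℝ 2 f (Ioo (-δ) δ)) (hf0 : deriv f 0 = 0) :
    ∃ L : ℝ, 0 ≤ L ∧ (∀ σ, |σ| ≤ δ / 2 → HasDerivAt f (deriv f σ) σ) ∧
      ∀ σ, |σ| ≤ δ / 2 → ‖deriv f σ‖ ≤ L * |σ| := by
  have hopen : IsOpen (Ioo (-δ) δ) := isOpen_Ioo
  have hsub : Icc (-(δ / 2)) (δ / 2) ⊆ Ioo (-δ) δ := fun x hx => ⟨by linarith [hx.1], by linarith [hx.2]⟩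
  have hmemI : ∀ σ, |σ| ≤ δ / 2 → σ ∈ Icc (-(δ / 2)) (δ / 2) := fun σ hσ => ⟨by linarith [(abs_le.1 hσ).1], (abs_le.1 hσ).2⟩
  -- `f` is differentiable on the open interval
  have hdiff : DifferentiableOn ℝ f (Ioo (-δ) δ) := hf.differentiableOn (by norm_num)
  have hderiv : ∀ σ ∈ Ioo (-δ) δ, HasDerivAt f (deriv f σ) σ := fun σ hσ =>
    ((hdiff σ hσ).differentiableAt (hopen.mem_nhds hσ)).hasDerivAt
  -- `g = f'` is `C¹` on the open interval: differentiable with continuous derivative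
  have hg : ContDiffOn ℝ 1 (deriv f) (Ioo (-δ) δ) := hf.deriv_of_isOpen hopen (by norm_num)
  have hg1 := (contDiffOn_succ_iff_deriv_of_isOpen (n := 0) hopen).1 (by simpa using hg)
  have hgdiff : DifferentiableOn ℝ (deriv f) (Ioo (-δ) δ) := hg1.1
  have hg'c : ContinuousOn (deriv (deriv f)) (Ioo (-δ) δ) := hg1.2.2.continuousOn
  -- bound `‖f''‖ ≤ L` on the compact sub-interval
  obtain ⟨L, hL⟩ := (isCompact_Icc : IsCompact (Icc (-(δ / 2)) (δ / 2))).exists_bound_of_continuousOn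
    (hg'c.mono hsub)
  set L' : ℝ := max L 0 with hL'
  refine ⟨L', le_max_right _ _, fun σ hσ => hderiv σ (hsub (hmemI σ hσ)), fun σ hσ => ?_⟩
  -- mean value inequality for `f'` on the convex interval
  have hmvt := (convex_Icc (-(δ / 2)) (δ / 2)).norm_image_sub_le_of_norm_hasDerivWithin_le
    (f := deriv f) (f' := fun x => deriv (deriv f) x) (C := L')
    (fun x hx => (((hgdiff x (hsub hx)).differentiableAt (hopen.mem_nhds (hsub hx))).hasDerivAt).hasDerivWithinAt)
    (fun x hx => (hL x hx).trans (le_max_left _ _))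
    (show (0 : ℝ) ∈ Icc (-(δ / 2)) (δ / 2) from ⟨by linarith, by linarith⟩) (hmemI σ hσ)
  rw [hf0, sub_zero, sub_zero, Real.norm_eq_abs] at hmvt
  exact hmvt

/-- **`‖f(σ) − f(0)‖ ≤ Lσ²`** from `HasDerivAt f (f' σ') σ'` and `‖f'(σ')‖ ≤ L|σ'|` for `|σ'| ≤ δ'`, `|σ| ≤ δ'`.
[folklore] -/
theorem norm_sub_le_mul_sq_of_deriv_le {f : ℝ → F} {f' : ℝ → F} {δ' L : ℝ} (hL : 0 ≤ L)
    (hfd : ∀ σ, |σ| ≤ δ' → HasDerivAt f (f' σ) σ) (hf' : ∀ σ, |σ| ≤ δ' → ‖f' σ‖ ≤ L * |σ|)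
    {σ : ℝ} (hσ : |σ| ≤ δ') : ‖f σ - f 0‖ ≤ L * σ ^ 2 := by
  set s : Set ℝ := Icc (-|σ|) |σ| with hs
  have hmem : ∀ x ∈ s, |x| ≤ |σ| := fun x hx => abs_le.2 ⟨hx.1, hx.2⟩
  have h1 := (convex_Icc (-|σ|) |σ|).norm_image_sub_le_of_norm_hasDerivWithin_le
    (f := f) (f' := f') (C := L * |σ|) (fun x hx => (hfd x ((hmem x hx).trans hσ)).hasDerivWithinAt)
    (fun x hx => (hf' x ((hmem x hx).trans hσ)).trans (mul_le_mul_of_nonneg_left (hmem x hx) hL))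
    (show (0 : ℝ) ∈ s from ⟨by simp, by simp⟩) (show σ ∈ s from ⟨neg_abs_le σ, le_abs_self σ⟩)
  rw [sub_zero, Real.norm_eq_abs] at h1
  calc ‖f σ - f 0‖ ≤ L * |σ| * |σ| := h1
    _ = L * σ ^ 2 := by rw [mul_assoc, ← sq, sq_abs]

end Summit.NavierStokesRegularity.NavierStokesRegularity.Theorems.PowerGaugeEulerLiouville.NodalContinuum
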